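import Summits.BirchSwinnertonDyer.BirchSwinnertonDyer.Theses.UniversalToricDescent
import Summits.BirchSwinnertonDyer.BirchSwinnertonDyer.Theorems.EisensteinPrimesHidaLimitFittingBoundConverse
import Summits.BirchSwinnertonDyer.Rank1Residual.X11b.BDPRouteOpenInputDegenerateFrame
import Literature.NumberTheory.EllipticCurves.CyclotomicIwasawaMainTheoremIrreducibleProofs
import HarnessLib

/-!
# NODE (D-0171) on crux stmt-BirchSwinnertonDyer-24207 `UniversalToricDescent.RationalSplitIMCInclusionAtThree`
# — idea `derived-antidiagonal-content-bound` (crux-ideate seat `cruxidea-stmt-BirchSwinnertonDyer-24207-1` gen 8, 2026-08-30)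

KIND: DECOMPOSITION through a DOOR, plus a NEGATIVE STRUCTURE THEOREM (B-g8-1) that redirects every
Euler-system supply for this crux.  The wall `∃ k, 3ᵏ·L ∈ Ch_Λ(X_(∅,0))·R₀⟦T⟧` (RATWALL; `X = XAc … 𝔭' ∅` is
strict at `𝔭'`, relaxed at the branch prime `𝔭` of `ι'`) is entered through

  **S (derived content supply)** ∧ **D (coprime-cofactor door)** ⟹ 24207      (kernel, BY NAME, below):

* **S** `DerivedContentSupplyAtThree` [UNDECIDED · door-half · EQUIV-mod-D with the wall (costume check
  `derivedContentSupply_of_wall`)]: on the wall's binders, with `X` torsion and `Ch·R₀⟦T⟧ = (F)`, there are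
  `k` and a COFACTOR `C ∈ R₀⟦T⟧` with NO COMMON ZERO with `F` in the open disc such that `F ∣ 3ᵏ·C·L`.
* **D** `CoprimeCofactorDoor` [WEAKER · ATTACKABLE (M)]: `F ≠ 0`, `F ∣ 3ᵏ·C·L`, `Z(F) ∩ Z(C) = ∅` in the open disc
  ⟹ `F ∣ 3^{k'}·L` (Weierstrass preparation `F = 3^μ·P·u` over the complete DVR `R₀ = W(𝔽̄₃)`; every
  distinguished irreducible factor `Pᵢ` of `P` has a root `xᵢ`, `|xᵢ| < 1`, where `C(xᵢ) ≠ 0`, so `Pᵢ ∤ 3ᵏC` and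
  `Pᵢ^{mᵢ} ∣ L` in the UFD `R₀⟦T⟧`; `k' = μ`).  [Washington GTM 83 §7.1; Bourbaki AC VII §3.8–3.9]

## THE LEVER (informal content of S; technique-differentiated from the nine cards on file)

**Derived anti-diagonal diagonal class + content bound (line-free Kolyvagin at `𝔭'`).**
Dictionary (TRANSFER from the CM sign −1 theory): elliptic-unit Euler system over `K` ↦ the `f_E`-FROZEN two-variable
anti-diagonal diagonal-cycle class `𝐳(f_E,𝐠,𝐡)` (`𝐠 = θ(ψ₁·)`, `𝐡 = θ(ψ₂·)` CM Hida families on the `𝔭`-axis, channel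
`V_f⊗V_𝐠⊗V_𝐡|_{G_K} = [T_f⊗ψ₁ψ₂ (CONSTANT)] ⊕ [T_f⊗ψ₁ψ₂ᶜ·φ^{1−c} (MOVING = our anticyclotomic line)]`; Castella–Do
arXiv:2303.06751 §2.3–2.4: "Γ⁻ = anti-diagonal in 𝒪_𝔭^{(1)}×𝒪_𝔭̄^{(1)}", p. 19); Rubin's vanishing of the Euler system
ON the sign −1 line ↦ **B-g8-1** below; the Rubin/Agboola–Howard DERIVED class ↦ `𝐳' := ∂_⊥𝐳|_{ac}` (derivative
transverse to the line, well defined because `𝐳|_{ac} = 0`); the Λ-adic height regulator ↦ ONE Λ-linear functional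
`λ` on `H¹_Iw(K_{𝔭'}, T)` evaluated on `loc_{𝔭'} 𝐳'`.  Mechanism:
(A) [ATTACKABLE (L) · algebra] Poitou–Tate for `(∅,0) ⊂ (∅,ℒ)` with `ℒ := sat(Λ·loc_{𝔭'}𝐳')` (a line DEFINED BY THE
    GLOBAL CLASS — no `(φ,Γ)`-triangulinity needed): `char X_(0,∅) = char(ℒ/Λ·loc_{𝔭'}Sel_(∅,ℒ))·char X_(0,ℒ^⊥)`, the
    structure `(∅,ℒ)` has core rank `(2+1)−2 = 1`, so ONE Kolyvagin system bounds `X_(0,ℒ^⊥)`; together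
    `char X_(0,∅) ∣ 3ᵃ·cont(loc_{𝔭'}𝐳')` where `cont(v)` = gcd of the coordinates of `v ∈ H¹_Iw(K_{𝔭'},T) ≅ Λ²`
    (BASIS-FREE; evades `JacquetVanishingNoLocalLine`); `c`-conjugation + `ι` carries `X_(0,∅)` to our `X_(∅,0)`.
(D) [ATTACKABLE (M)] `𝐳'` inherits the tame norm relations (derivative of an Euler system vanishing on a line;
    Castella–Do Prop. 2.3.1 for the tame relations of `𝐳`).
(R) [IDEA-NEEDED · hardest] one-coordinate DERIVED reciprocity: `∃ λ, λ(loc_{𝔭'}𝐳') = 3ᵏ·C·L` with `C` root-disjoint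
    from `F` (candidate `λ = ⟨·, loc_{𝔭'} ᶜ𝐳'⟩_Λ`, a Λ-adic height-type regulator as in Rubin 1992 / Agboola–Howard
    2005 / Castella–Hsu–Kundu–Lee–Liu arXiv:2308.10474 §3 "derived regulator"); since `cont ∣ λ(·)`, (A)+(R) give S.
(E1') [IDEA-NEEDED · geometric] existence of the `f_E`-frozen class at `27 ∥ N_f`: BSV sheaf formalism with the
    weight-0 sheaf `𝒜'_0` in the `f`-slot on `Y₁(N_f)` (no family through `f`, no `U₃` on `f`) — see B-g8-2.
(G)  [ATTACKABLE (S) · Weierstrass] root-disjointness of `C` from `F`: `F` has finitely many disc roots; if `C` is a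
    nonzero CONSTANT (un-derived pin `C = L(x₀)`) it has none.

## B-g8-1 — LINE-RESTRICTION VANISHING at additive split 3 (barrier note; kills the un-derived version)
Let `𝐳 ∈ H¹(K, T₃E⊗ν⊗Λ_ac)` be ANY integral Λ_ac-adic class on the Heegner line of a `ClassO6` curve, `X_(∅,0)` torsion.
(S1) Euler–Poincaré over `K`: `rk Sel^cpt_ℱ − rk X_{ℱ*} = Σ_{v∣3} rk ℱ_v − 2`; `c`-symmetry (E/ℚ, ν of 3-power order)
     gives `rk X_(∅,0) = rk X_(0,∅) = 0`, hence `Sel^cpt_(∅,0) = Sel^cpt_(0,∅) = 0` (H¹_Iw torsion-free as `E(K_∞)[3]=0`).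
(S3) Honda `Ê ≅ Ĝ_a` at additive 3 (B-g5-5): a local class in `H¹_Iw(K_{v,∞}^{ac}, T)` whose specialisations at ALL
     classical points `ζ−1` are crystalline is `0` (no universal norms).
⟹ a nonzero `𝐳` is NON-crystalline at infinitely many classical points at EACH of `𝔭`, `𝔭'`.  COROLLARY: any family
whose classical specialisations are Selmer classes at both primes (Heegner: K1; restricted BF; the UN-derived
anti-diagonal class, whose specialisations `κ(f,g_φ,h_{φ⁻¹})` are crystalline by the Darmon–Rotger dichotomy since
both channel central values have sign −1) is IDENTICALLY ZERO on the line.  Only DERIVED (transverse-derivative) or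
SIGNED-type classes can carry Λ_ac-adic information at additive 3 — whence the lever above.  TETRAD (ask Q-g8-1): the
four expectations {E1' two-variable integral class, bounded two-variable reciprocity law, factorisation
`𝓛_p^𝐠|_{line} = C·L` with `C ≠ 0`, DR-dichotomy at additive 3} are jointly inconsistent with (S1)+(S3); which one fails
decides whether (R) is a derivative formula (`∂_⊥𝓛_p^𝐠|_{line}`) or an `ε`-normalised one.

## B-g8-2 — TOWER MULTIPLICITY (answers gen-0's "two-term relation" death precisely)
With `f_E` frozen at level `N_f` and `C_{r} = X(Γ₁(M3^{r})∩Γ₀(N'))` in the CM slots, every degeneracy push-forward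
`C_{r+1}² → C_r²` of the diagonal class carries either `U₃` on `f_E` (`= 0`) or the scalar `|G_r| = 3` of the new
diamond operators: `(1,pr₂,pr₂)_*Δ_{r+1} = 3·(U₃⊗1⊗1)Δ_r`, `(1,pr₁,pr₂)_*Δ_{r+1} = 3·(1⊗1⊗U₃ᵗ)Δ_r`,
`(1,pr₁,pr₁)_*Δ_{r+1} = 9·Δ_r`.  So NO tower of cycles is norm-compatible integrally; the only integral packaging is
the BSV/Castella–Do invariant `Det` on `T'×T×T` with weight variation in the coefficients (E1'), whose restriction to
the anticyclotomic line then falls under B-g8-1.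

## B-g8-3 — Castella–Do import is not a line here
CD Thm. 3.3.3 (I) (rank-one `Sel_{rel,str}`) is the DEFINITE-`K`, `χ`-dominant regime; the crux forces Heegner `K`
(sign −1, `f`-dominant), where CD's informative class is `ᶜ𝐳 ∈ Sel_{ord,ord}` (Thm. 3.3.3 (II)) — it needs `F⁺V_f`,
dead for supercuspidal `f_E` (K1); and Thm. 3.6.1 needs `f` ordinary, `p ≥ 5`, Hsieh's unit (pp. 20–23, 38–39).

INSTRUMENT DATA CITED: none new since gen 5 (asks D-g7-1/2/3, F1, D-g6-1, D-g5-1, D-g2-1/2 unrun); this node's asks: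
Q-g8-1 (tetrad, literature), F-g8-1 (local trilinear zeta integral at 3 for sc ⊗ ord ⊗ ord along the anti-diagonal),
A-g8-1 (is the MR/JNS core-rank-1 machine admissible at p = 3 with `ρ̄₃` onto and `3 ∥ cond`?).
-/

set_option linter.dupNamespace false

open scoped Classical

namespace Summit.BirchSwinnertonDyer.BirchSwinnertonDyer.Cruxes.RationalSplitIMCInclusionAtThree.DerivedAntiDiagonalContent

open PowerSeries Literature.NumberTheory.EllipticCurves Summit.BirchSwinnertonDyer.Rank1Residual.X11b

/-- `F` and `C` have no common zero in the open unit disc of `ℂ₃` (values via the tree's `UnrSeries.HasValueAt`). -/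
def RootDisjoint (F C : UnrSeries 3) : Prop :=
  ∀ x : ℂ_[3], ‖x‖ < 1 → F.HasValueAt x 0 → ¬ C.HasValueAt x 0

/-- **D [WEAKER · ATTACKABLE (M)]** the coprime-cofactor door: `F ≠ 0`, `Z(F) ∩ Z(C) = ∅` on the open disc and
`F ∣ 3ᵏ·C·L` imply `F ∣ 3^{k'}·L` in `R₀⟦T⟧` (Weierstrass preparation over `R₀ = W(𝔽̄₃)` + unique factorisation;
a nonzero constant `C` is the un-derived special case). [Washington GTM 83 §7.1; Bourbaki AC VII §3] -/
def CoprimeCofactorDoor : Prop :=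
  ∀ F L C : UnrSeries 3, F ≠ 0 → RootDisjoint F C →
    (∃ k : ℕ, ((3 : ℕ) : UnrSeries 3) ^ k * (C * L) ∈ Ideal.span {F}) →
    ∃ k : ℕ, ((3 : ℕ) : UnrSeries 3) ^ k * L ∈ Ideal.span {F}

/-- **S [UNDECIDED · door-half · EQUIV-mod-D]** derived content supply: on the wall's binders, with `X_(∅,0)` torsion
and `Ch_Λ(X)·R₀⟦T⟧ = (F)`, some `3ᵏ·C·L` lies in `(F)` for a cofactor `C` root-disjoint from `F`.  Informal producer:
(A) content bound `char X ∣ 3ᵃ·cont(loc_{𝔭'} 𝐳')` for the DERIVED anti-diagonal diagonal class, (R) one functional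
with `λ(loc_{𝔭'} 𝐳') = 3ᵇ·C·L`, (G) genericity of the auxiliary pair.  Leaves: A ATTACKABLE(L), D ATTACKABLE(M),
R IDEA-NEEDED, E1' IDEA-NEEDED, G ATTACKABLE(S); barrier B-g8-1 discharged by DERIVING (specialisations of `𝐳'` are
non-crystalline). -/
def DerivedContentSupplyAtThree : Prop :=
  ∀ (W : WeierstrassCurve ℚ) [W.IsElliptic] [W.IsGloballyMinimal] (N : ℕ) [NeZero N] (K : Type) [Field K] [NumberField K] (Dt : Literature.NumberTheory.EllipticCurves.ModularForms.ModularParametrizationData W N), Summit.BirchSwinnertonDyer.Rank1Residual.Additive.ClassO6 W 3 → W.HasSurjectiveModNGaloisRep 3 → W.analyticRank = 1 → W.conductorNorm ℤ = N → Literature.NumberTheory.EllipticCurves.IsImaginaryQuadratic K → Literature.NumberTheory.EllipticCurves.SatisfiesHeegnerHypothesis N K → ∀ (κ : Literature.NumberTheory.EllipticCurves.ZpExtension K 3), κ.IsAnticyclotomic → ∀ (γ : Field.absoluteGaloisGroup K) [Fact (κ.IsTopGenerator γ)] (𝔭 : IsDedekindDomain.HeightOneSpectrum (NumberField.RingOfIntegers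 K)), ((3 : ℕ) : NumberField.RingOfIntegers K) ∈ 𝔭.asIdeal → 𝔭.asIdeal.ramificationIdx (NumberField.RingOfIntegers ℚ) = 1 → 𝔭.asIdeal.inertiaDeg (NumberField.RingOfIntegers ℚ) = 1 → ∀ (𝔭' : IsDedekindDomain.HeightOneSpectrum (NumberField.RingOfIntegers K)), ((3 : ℕ) : NumberField.RingOfIntegers K) ∈ 𝔭'.asIdeal → 𝔭' ≠ 𝔭 → ∀ (ι' : PadicAlgCl 3 ≃+* ℂ), Summit.BirchSwinnertonDyer.BirchSwinnertonDyer.Theorems.SchneiderFree.BranchInducesPrime 3 ι' 𝔭 → ∀ (ΩK : ℂ) (Ωp : ℂ_[3]) (L : Literature.NumberTheory.EllipticCurves.UnrSeries 3), ΩK ≠ 0 → Ωp ≠ 0 → Literature.NumberTheory.EllipticCurves.IsBDPLFunction ι' 𝔭 κ γ Dt.f ΩK Ωp L → Module.IsTorsion (Literature.NumberTheory.EllipticCurves.IwasawaAlgebra 3) (Summit.BirchSwinnertonDyer.Rank1Residual.X11b.AcSelmer.XAc (W.baseChange K) 3 κ 𝔭' ∅ γ) → ∀ F : Literature.NumberTheory.EllipticCurves.UnrSeries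 3, (Summit.BirchSwinnertonDyer.Rank1Residual.X11b.AcSelmer.XAc.charIdeal (W.baseChange K) 3 κ 𝔭' ∅ γ).map (PowerSeries.map (Summit.BirchSwinnertonDyer.Rank1Residual.X11b.Halves.toUnr 3)) = Ideal.span {F} →
    ∃ (k : ℕ) (C : Literature.NumberTheory.EllipticCurves.UnrSeries 3),
      RootDisjoint F C ∧ ((3 : ℕ) : Literature.NumberTheory.EllipticCurves.UnrSeries 3) ^ k * (C * L) ∈ Ideal.span {F}

/-! ## Helper facts (verbatim currency of the gen-3…7 nodes) -/

/-- The extended characteristic ideal is principal: `Ch_Λ(X)·R₀⟦T⟧ = (F)`. -/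
theorem exists_map_charIdeal_eq_span {K : Type} [Field K] [NumberField K] (W : WeierstrassCurve K)
    (κ : ZpExtension K 3) (𝔭' : IsDedekindDomain.HeightOneSpectrum (NumberField.RingOfIntegers K))
    (γ : Field.absoluteGaloisGroup K) [Fact (κ.IsTopGenerator γ)] :
    ∃ F : UnrSeries 3, (AcSelmer.XAc.charIdeal W 3 κ 𝔭' ∅ γ).map (PowerSeries.map (Halves.toUnr 3)) =
      Ideal.span {F} := by
  obtain ⟨f, hf⟩ := (charIdeal_isPrincipal_holds 3 (AcSelmer.XAc W 3 κ 𝔭' ∅ γ)).principal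
  refine ⟨PowerSeries.map (Halves.toUnr 3) f, ?_⟩
  have hf' : AcSelmer.XAc.charIdeal W 3 κ 𝔭' ∅ γ = Ideal.span {f} := by
    change Literature.NumberTheory.EllipticCurves.Module.charIdeal (IwasawaAlgebra 3) (AcSelmer.XAc W 3 κ 𝔭' ∅ γ) =
      Ideal.span {f}
    simpa [Ideal.submodule_span_eq] using hf
  rw [hf', Ideal.map_span, Set.image_singleton]

/-- The extended characteristic ideal is nonzero (`Ch_Λ ≠ ⊥` over a domain, `Λ → R₀⟦T⟧` injective). -/
theorem map_charIdeal_ne_bot {K : Type} [Field K] [NumberField K] (W : WeierstrassCurve K)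
    (κ : ZpExtension K 3) (𝔭' : IsDedekindDomain.HeightOneSpectrum (NumberField.RingOfIntegers K))
    (γ : Field.absoluteGaloisGroup K) [Fact (κ.IsTopGenerator γ)] :
    (AcSelmer.XAc.charIdeal W 3 κ 𝔭' ∅ γ).map (PowerSeries.map (Halves.toUnr 3)) ≠ ⊥ := by
  rw [Ne, Ideal.map_eq_bot_iff_of_injective map_toUnr_injective]
  exact Literature.NumberTheory.EllipticCurves.Module.charIdeal_ne_bot (IwasawaAlgebra 3) _

/-- The constant series `1` takes the value `1` at every point of the disc. -/
theorem one_hasValueAt (x : ℂ_[3]) : (1 : UnrSeries 3).HasValueAt x 1 := by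
  have h := hasSum_single (f := fun k : ℕ ↦
      ((PowerSeries.coeff k (1 : UnrSeries 3) : unrIntegers 3) : ℂ_[3]) * x ^ k) 0
    (fun k hk ↦ by simp [PowerSeries.coeff_one, hk])
  simpa [UnrSeries.HasValueAt, PowerSeries.coeff_one] using h

/-- A nonzero constant cofactor is root-disjoint from anything: the case `C = 1`. -/
theorem rootDisjoint_one (F : UnrSeries 3) : RootDisjoint F 1 :=
  fun x _ _ h1 ↦ one_ne_zero ((one_hasValueAt x).unique h1)

/-! ## The composition (kernel, BY NAME) and the costume check -/

/-- **S ∧ D ⟹ 24207.**  On the wall's binders: if `X_(∅,0)` is not Λ-torsion its characteristic ideal is `⊤`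
(`k = 0`); otherwise `Ch·R₀⟦T⟧ = (F)` with `F ≠ 0`, **S** supplies `3ᵏ·C·L ∈ (F)` with `C` root-disjoint from `F`,
and the door **D** strips the cofactor. -/
theorem rationalSplitIMCInclusionAtThree_of_supply_of_door
    (hS : DerivedContentSupplyAtThree) (hD : CoprimeCofactorDoor) :
    Summit.BirchSwinnertonDyer.BirchSwinnertonDyer.Theses.UniversalToricDescent.RationalSplitIMCInclusionAtThree := by
  intro W _ _ N _ K _ _ Dt hO6 hsurj hr1 hN hK hH κ hκ γ _ 𝔭 h𝔭 he hf 𝔭' h𝔭' hne ι' hι ΩK Ωp L hΩK hΩp hL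
  by_cases htor : Module.IsTorsion (IwasawaAlgebra 3) (AcSelmer.XAc (W.baseChange K) 3 κ 𝔭' ∅ γ)
  · obtain ⟨F, hF⟩ := exists_map_charIdeal_eq_span (W.baseChange K) κ 𝔭' γ
    have hF0 : F ≠ 0 := by
      intro h0
      apply map_charIdeal_ne_bot (W.baseChange K) κ 𝔭' γ
      rw [hF, h0, Ideal.span_singleton_eq_bot]
    obtain ⟨k, C, hdisj, hmem⟩ := hS W N K Dt hO6 hsurj hr1 hN hK hH κ hκ γ 𝔭 h𝔭 he hf 𝔭' h𝔭' hne ι' hι ΩK Ωp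
      L hΩK hΩp hL htor F hF
    obtain ⟨k', hk'⟩ := hD F L C hF0 hdisj ⟨k, hmem⟩
    exact ⟨k', by rw [hF]; exact hk'⟩
  · refine ⟨0, ?_⟩
    have htop : AcSelmer.XAc.charIdeal (W.baseChange K) 3 κ 𝔭' ∅ γ = ⊤ :=
      Summit.BirchSwinnertonDyer.BirchSwinnertonDyer.Theorems.charIdeal_eq_top_of_not_isTorsion (p := 3) _ htor
    rw [htop, Ideal.map_top]; exact Submodule.mem_top

/-- **Costume check (evidence for the EQUIV-mod-D tag of S):** the wall gives S with the trivial cofactor `C = 1`.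
So S carries content only through its informal producer (the derived class); the typed decomposition is a DOOR. -/
theorem derivedContentSupply_of_wall
    (h : Summit.BirchSwinnertonDyer.BirchSwinnertonDyer.Theses.UniversalToricDescent.RationalSplitIMCInclusionAtThree) :
    DerivedContentSupplyAtThree := by
  intro W _ _ N _ K _ _ Dt hO6 hsurj hr1 hN hK hH κ hκ γ _ 𝔭 h𝔭 he hf 𝔭' h𝔭' hne ι' hι ΩK Ωp L hΩK hΩp hL _ F hF
  obtain ⟨k, hk⟩ := h W N K Dt hO6 hsurj hr1 hN hK hH κ hκ γ 𝔭 h𝔭 he hf 𝔭' h𝔭' hne ι' hι ΩK Ωp L hΩK hΩp hL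
  refine ⟨k, 1, rootDisjoint_one F, ?_⟩
  rw [one_mul, ← hF]; exact hk

end Summit.BirchSwinnertonDyer.BirchSwinnertonDyer.Cruxes.RationalSplitIMCInclusionAtThree.DerivedAntiDiagonalContent
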